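import Summits.QuantumFields.YangMills.Theorems.BalabanUVNodesN21AxialCombDictionary
import Literature.MathematicalPhysics.QuantumFieldTheory.Balaban1983to89.LatticeFieldCalculus

/-!
# N21 (NE7c) · THE TORUS (1.8): print's Poincaré inequality (1.8) ON pub-balaban's TORUS CARRIERS in the AXIAL COMB GAUGE of a
# non-wrapping box, and the (M1) ENDs' (1.9) binder on `BlockChartSU N b` for EVERY block `b` off the comb, from the (1.7) row
# stated in TORUS letters (file 11 of WIDTH-209 N21 piece 2; part III of the axial-comb dictionary p639034 ∕ p639994)

Width seat pub-ymgap-dag-n21-w3 (g6), node N21 = NE7c (NOT PRINTED, NOT proved), lane K3⁸ `SpineGivenEndpointR13SepCoPHV`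
(stmt-QuantumFields-27366, `--kind proof --supports … --as helper`; K3⁷ 20544 = aside ∕ lineage).  Imports part I
`…N21AxialCombDictionary` (p639034: `castBond (z, μ) = ⟨castSite z, μ⟩` identifies `B16Eq18Proof`'s `ℤ^d` box ∕ comb ∕ inner
plaquettes with pub-balaban's `boxBonds` ∕ `combBonds` ∕ `boxPlaqs` of a non-wrapping torus box `[lo, hi]`) and the lattice
calculus of record `LatticeFieldCalculus` (the torus plaquette variable `curl c A p`, [Balaban1984PropagatorsI] (1.2)).

WHY.  Files 6–10 of this piece read the ENDs' coercivity binder `h19` from print's (1.7) row asked against the curl energy of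
a `ℤ^d` configuration (the chart vector pulled back along `castBond`, `B6TreeGaugePoincare.curl` over `B16Eq18Proof.innerPlaq`).
The lane speaks TORUS letters: NODE O's flat Hessian identity (`K0Stub1FlatHessianLandauCoercivity`,
`inner_hessOpAt_one_self_eq_sum_curl_normSq`) is `⟪X, Δ_1X⟫ = N⁻¹·Σ_{p : Plaq} Σ|(curl 1 X)(p)|²` (`curl 1` on `Plaq P j`); dag-n21-w2's
junction №5 ∕ dag-n21-w1 g3's `N21WindowLetterAlgebra` §1b quantify over blocks `b` of TORUS box bonds in the COMB gauge
(`hbox : ∀ i ∈ b, i ∈ boxBonds lo hi`, `hcomb : ∀ i ∈ b, i ∉ combBonds lo hi`).  This file transports (1.8) itself to the torus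
carriers — the LINEAR twin of pub-balaban's `T4AxialGaugeSmallField` §2 (which transports the GROUP-level Poincaré lemma) — so
that the (1.7) row is displayed, and `h19` read, with NO `ℤ^d` object in the statement.

WHAT (THEOREMS ONLY; 0 `def`, 0 `sorry`).  «Non-wrapping» = `hi κ − lo κ < P.sitesPerDir j` ∀ κ; sides `hi_κ + 1 − lo_κ ≤ 100M`.
* §1 [folklore] THE CURL DICTIONARY: `curl_castSite` (`curl c W ⟨castSite z, i, μ⟩` in box letters, `castSite_add_e`) and
  `curl_one_castSite_apply` (`(curl 1 W ⟨castSite z, i, μ⟩)_a = B6TreeGaugePoincare.curl (W ∘ castBond · a) z i μ`).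
* §2 [folklore] `comp_castBond_eq_zero_of_combGauge` (comb gauge on the torus ⇒ the pull-back vanishes on `treeBonds`),
  `sum_boxBonds_le_sum_innerBonds` ∕ `sum_innerPlaq_le_sum_boxPlaqs` (monotone re-indexing of non-negative sums along
  `castBond` ∕ `castPlaq`, non-wrapping box).
* §3 ★ `ineq18_torusBox_of_combGauge` — THE TORUS (1.8): for `W : VecField P j (Fin D → ℝ)` vanishing on `combBonds lo hi`,
  `Ineq18 (Σ_{b ∈ S_b} Σ_a (W b a)²) (Σ_{p ∈ S_p} Σ_a (curl 1 W p a)²) d M` for ANY finset `S_b` of box bonds and ANY finset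
  `S_p ⊇ boxPlaqs lo hi` (e.g. `univ`); ★ `ineq18_torusBox_of_combGauge_real` (real-valued `W`).
* §4 ★★ `ineq19_blockChartSU_of_ineq17_torus`: on `BlockChartSU N b`, for EVERY block `b` with `hbox` ∕ `hcomb`, the (1.7) row —
  asked of the quadratic member against `Σ_{p ∈ S_p} Σ_a |(curl 1 v̄)(p)_a|²`, `v̄` = the chart vector EXTENDED BY ZERO to all
  torus bonds — plus `1 ≤ d`, sides, `1 ≤ M`, `0 ≤ γ₀` and the smallness line ⇒ `∀ v, Ineq19 (Qf v) (Σ_{b′} ‖v b′‖²) γ₀ d M`.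
* §5 ★★ `convexOn_blockChartSU_expansion_of_ineq17_torus_analyticSupBound`: file 5-local's ★★′-loc on that chart with `h19`
  discharged by §4.
* §6 A6 `ineq17_torus_binders_inhabited` (§4's list jointly inhabited NON-TRIVIALLY on every such block: `Qf :=` the torus curl
  energy of `v̄`, `γ₀ = 1`, `C = 0`; §4 then returns the rescaled torus (1.8) on the block chart) and A2
  `ineq18_torus_void_without_combGauge` (a CONSTANT bond field is curl-free on every torus plaquette: without the comb clause
  the conclusion of §3 fails on any non-empty `S_b` — the gauge clause is load-bearing).

HONEST FRAMING.  [folklore] lattice bookkeeping + tree theorems BY NAME (`B16Eq18Proof.ineq18_box_vec` ∕ `ineq18_box_real`,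
`B16Sect1Wilson.ineq19_of_17_18`, p639034's dictionary, file 5-local); (1.7) stays a DISPLAYED ROW about NODE O's `Δ₁(ζ₀)`, NOT
asserted; WHICH box `[lo, hi]` ∕ block `b` the lane's (M1) package fixes is dag-n21-w2 ∕ dag-n21-d's decision; the identification of
an END's `Qf` with `⟨H_{1,k}B′, Δ₁(ζ₀)H_{1,k}B′⟩` is LOCATED typing; nothing of Bałaban's asserted; (M1) ∕ NE7c NOT PRINTED ∕ NOT
proved; N21 NOT discharged; K3⁸ NOT claimed; counts unmoved (typed 28∕28 · discharged 5∕27); count-neutral; one finite 𝕋⁴ at fixed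
ε — the Yang–Mills mass gap (Clay) is NOT proved by any of this: R4 closes the conditional finite-𝕋⁴ rung `BalabanLadder.UV` only;
nothing continuum ∕ ℝ⁴ ∕ OS.
-/

set_option autoImplicit false

noncomputable section

open Set Function Finset Matrix Metric

namespace Summit.QuantumFields.YangMills.Theorems.N21TorusBoxCombGaugePoincare

open Literature.MathematicalPhysics.QuantumFieldTheory.Balaban1983to89
open Literature.MathematicalPhysics.QuantumFieldTheory.Balaban1983to89.B16Sect1Wilson
  (Ineq17 Ineq18 Ineq19 ineq19_of_17_18)
open Literature.MathematicalPhysics.QuantumFieldTheory.Balaban1983to89.B16Eq18Proof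
  (treeBonds innerBonds innerPlaq mem_innerPlaq ineq18_box_vec ineq18_box_real)
open Literature.MathematicalPhysics.QuantumFieldTheory.Balaban1983to89.B7Prop1Explicit (e e_apply)
open Literature.MathematicalPhysics.QuantumFieldTheory.Balaban1983to89.T4AxialGaugeSmallField
  (castSite castSite_add_e castSite_injOn_box boxBonds boxPlaqs)
open Literature.MathematicalPhysics.QuantumFieldTheory.Balaban1983to89.T4AxialGaugeFixing (combSet combBonds mem_combBonds)
open Literature.MathematicalPhysics.QuantumFieldTheory.Balaban1983to89.LatticeFieldCalculus (curl)
open Summit.QuantumFields.BalabanUV.T4Continuum.ShellMeasureExpChartSUN (BlockChartSU dimSU)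
open Summit.QuantumFields.YangMills.Theorems.N21LowCentreEndAtSUNBlockChart (sum_sq_flatten)
open Summit.QuantumFields.YangMills.Theorems.N21ChartExponentConvexityLocalSUN
  (convexOn_blockChartSU_expansion_of_analyticSupBound_local)
open Summit.QuantumFields.YangMills.Theorems.N21AxialCombDictionary
  (e_eq_unitVec mem_box_sides_iff sides_le_of_le castBond_injOn_innerBonds coe_image_castBond_innerBonds
    castPlaq_mem_boxPlaqs_iff image_castBond_treeBonds)

variable {P : Params} {j : ℕ}

/-! ## §1  The curl dictionary: the torus plaquette variable at `⟨castSite z, i, μ⟩` is the `ℤ^d` circulation of the pull-back -/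

section CurlDictionary

variable {V : Type*} [AddCommGroup V] [Module ℝ V]

/-- THE CURL DICTIONARY, box letters: the torus plaquette variable ([Balaban1984PropagatorsI] (1.2)) of `W` at the plaquette
based at `castSite z` spanned by `(e_i, e_μ)` reads the four bonds `⟨castSite z, i⟩`, `⟨castSite (z + e_i), μ⟩`,
`⟨castSite (z + e_μ), i⟩`, `⟨castSite z, μ⟩` (`castSite_add_e`). [cite: Balaban1984PropagatorsI, (1.2) p.18] [folklore] -/
theorem curl_castSite (c : ℝ) (W : VecField P j V) (z : Fin P.d → ℤ) {i μ : Fin P.d} (h : i < μ) :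
    curl c W ⟨castSite z, i, μ, h⟩ =
      c • (W ⟨castSite z, i⟩ + W ⟨castSite (z + e i), μ⟩ - W ⟨castSite (z + e μ), i⟩ - W ⟨castSite z, μ⟩) := by
  simp only [curl, castSite_add_e]

/-- THE CURL DICTIONARY, componentwise: for a bond field with values in `ι → ℝ` (components `a : ι` in a basis of 𝔤), the
`a`-th component of the torus plaquette variable `(curl 1 W)(⟨castSite z, i, μ⟩)` IS `B6TreeGaugePoincare.curl` of the
pulled-back `ℤ^d` configuration `(z′, κ) ↦ W ⟨castSite z′, κ⟩ a` at `(z, i, μ)`. [cite: Balaban1984PropagatorsI, (1.2) p.18] [folklore] -/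
theorem curl_one_castSite_apply {ι : Type*} (W : VecField P j (ι → ℝ)) (a : ι) (z : Fin P.d → ℤ) {i μ : Fin P.d}
    (h : i < μ) :
    curl 1 W ⟨castSite z, i, μ, h⟩ a =
      B6TreeGaugePoincare.curl (fun bd : (Fin P.d → ℤ) × Fin P.d => W ⟨castSite bd.1, bd.2⟩ a) z i μ := by
  rw [curl_castSite, one_smul, B6TreeGaugePoincare.curl, ← e_eq_unitVec, ← e_eq_unitVec]
  simp only [Pi.add_apply, Pi.sub_apply]

end CurlDictionary

/-! ## §2  The comb gauge pulled back; monotone re-indexing of bond and plaquette sums along the dictionary -/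

section Reindex

variable {lo hi : Fin P.d → ℤ}

/-- COMB GAUGE ON THE TORUS ⇒ TREE GAUGE ON `ℤ^d`: if `W` vanishes on pub-balaban's `combBonds lo hi`, its pull-back along
`castBond` vanishes on `B16Eq18Proof.treeBonds` of the box (`image_castBond_treeBonds`). [folklore] -/
theorem comp_castBond_eq_zero_of_combGauge {V : Type*} [Zero V] (W : VecField P j V)
    (hW : ∀ b ∈ (combBonds lo hi : Finset (PBond P j)), W b = 0) :
    ∀ bd ∈ treeBonds (fun κ => (hi κ + 1 - lo κ).toNat) lo, W ⟨castSite bd.1, bd.2⟩ = 0 := by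
  intro bd hbd
  refine hW _ ?_
  rw [← image_castBond_treeBonds (lo := lo) (hi := hi)]
  exact Finset.mem_image_of_mem _ hbd

/-- BOND SUMS: a non-negative function summed over any finset of BOX BONDS is at most its sum over the images of ALL inner
bonds of the `ℤ^d` box, i.e. the pulled-back sum over `innerBonds` (non-wrapping box: `castBond` injective,
`coe_image_castBond_innerBonds`). [folklore] -/
theorem sum_boxBonds_le_sum_innerBonds (hN : ∀ κ, hi κ - lo κ < P.sitesPerDir j) (g : PBond P j → ℝ) (hg : ∀ b, 0 ≤ g b)
    (Sb : Finset (PBond P j)) (hSb : ∀ b ∈ Sb, b ∈ (boxBonds lo hi : Set (PBond P j))) :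
    ∑ b ∈ Sb, g b ≤ ∑ bd ∈ innerBonds (fun κ => (hi κ + 1 - lo κ).toNat) lo, g ⟨castSite bd.1, bd.2⟩ := by
  have hsub : Sb ⊆ (innerBonds (fun κ => (hi κ + 1 - lo κ).toNat) lo).image
      fun bd : (Fin P.d → ℤ) × Fin P.d => (⟨castSite bd.1, bd.2⟩ : PBond P j) := by
    intro b hb
    have h : b ∈ (boxBonds lo hi : Set (PBond P j)) := hSb b hb
    rw [← coe_image_castBond_innerBonds (lo := lo) (hi := hi)] at h
    exact Finset.mem_coe.1 h
  calc ∑ b ∈ Sb, g b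
      ≤ ∑ b ∈ (innerBonds (fun κ => (hi κ + 1 - lo κ).toNat) lo).image
          fun bd : (Fin P.d → ℤ) × Fin P.d => (⟨castSite bd.1, bd.2⟩ : PBond P j), g b :=
        Finset.sum_le_sum_of_subset_of_nonneg hsub fun b _ _ => hg b
    _ = ∑ bd ∈ innerBonds (fun κ => (hi κ + 1 - lo κ).toNat) lo, g ⟨castSite bd.1, bd.2⟩ :=
        Finset.sum_image (castBond_injOn_innerBonds hN)

/-- PLAQUETTE SUMS: a function `G` on the inner plaquettes of the `ℤ^d` box that agrees with a non-negative `g` on the torus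
plaquettes `⟨castSite z, i, μ⟩` is summed over `innerPlaq` to at most the sum of `g` over ANY finset `S_p ⊇ boxPlaqs lo hi`
(non-wrapping box: `castPlaq` injective on the inner plaquettes, `castPlaq_mem_boxPlaqs_iff`). [folklore] -/
theorem sum_innerPlaq_le_sum_boxPlaqs (hN : ∀ κ, hi κ - lo κ < P.sitesPerDir j) (g : Plaq P j → ℝ) (hg : ∀ p, 0 ≤ g p)
    (G : (Fin P.d → ℤ) × Fin P.d × Fin P.d → ℝ)
    (hG : ∀ q ∈ innerPlaq (fun κ => (hi κ + 1 - lo κ).toNat) lo, ∀ h : q.2.1 < q.2.2,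
      G q = g ⟨castSite q.1, q.2.1, q.2.2, h⟩)
    (Sp : Finset (Plaq P j)) (hSp : (boxPlaqs lo hi : Set (Plaq P j)) ⊆ ↑Sp) :
    ∑ q ∈ innerPlaq (fun κ => (hi κ + 1 - lo κ).toNat) lo, G q ≤ ∑ p ∈ Sp, g p := by
  classical
  -- the dictionary on the inner plaquettes (the orientation proof is part of the membership)
  let I : ↥(innerPlaq (fun κ => (hi κ + 1 - lo κ).toNat) lo) → Plaq P j :=
    fun q => ⟨castSite q.1.1, q.1.2.1, q.1.2.2, (mem_innerPlaq.1 q.2).2.1⟩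
  have hbox : ∀ q : ↥(innerPlaq (fun κ => (hi κ + 1 - lo κ).toNat) lo), lo ≤ q.1.1 ∧ q.1.1 ≤ hi := fun q =>
    (mem_box_sides_iff (d := P.d)).1 (mem_innerPlaq.1 q.2).1
  have hinj : ∀ q ∈ (innerPlaq (fun κ => (hi κ + 1 - lo κ).toNat) lo).attach,
      ∀ q' ∈ (innerPlaq (fun κ => (hi κ + 1 - lo κ).toNat) lo).attach, I q = I q' → q = q' := by
    intro q _ q' _ hqq
    have hsrc : (castSite q.1.1 : Site P j) = castSite q'.1.1 := congrArg Plaq.src hqq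
    have hμ : q.1.2.1 = q'.1.2.1 := congrArg Plaq.μ hqq
    have hν : q.1.2.2 = q'.1.2.2 := congrArg Plaq.ν hqq
    have hz : q.1.1 = q'.1.1 := castSite_injOn_box hN (hbox q).1 (hbox q).2 (hbox q').1 (hbox q').2 hsrc
    exact Subtype.ext (Prod.ext hz (Prod.ext hμ hν))
  have hmem : (innerPlaq (fun κ => (hi κ + 1 - lo κ).toNat) lo).attach.image I ⊆ Sp := by
    intro p hp
    obtain ⟨q, -, rfl⟩ := Finset.mem_image.1 hp
    refine Finset.mem_coe.1 (hSp ?_)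
    exact (castPlaq_mem_boxPlaqs_iff hN (hbox q) (mem_innerPlaq.1 q.2).2.1).2 (by
      have hq := q.2
      rcases q with ⟨⟨z, i, μ⟩, _⟩
      exact hq)
  calc ∑ q ∈ innerPlaq (fun κ => (hi κ + 1 - lo κ).toNat) lo, G q
      = ∑ q ∈ (innerPlaq (fun κ => (hi κ + 1 - lo κ).toNat) lo).attach, G q.1 := (Finset.sum_attach _ _).symm
    _ = ∑ q ∈ (innerPlaq (fun κ => (hi κ + 1 - lo κ).toNat) lo).attach, g (I q) :=
        Finset.sum_congr rfl fun q _ => hG q.1 q.2 (mem_innerPlaq.1 q.2).2.1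
    _ = ∑ p ∈ (innerPlaq (fun κ => (hi κ + 1 - lo κ).toNat) lo).attach.image I, g p := (Finset.sum_image hinj).symm
    _ ≤ ∑ p ∈ Sp, g p := Finset.sum_le_sum_of_subset_of_nonneg hmem fun p _ _ => hg p

end Reindex

/-! ## §3  ★ THE TORUS (1.8): the Poincaré inequality in the axial comb gauge of a non-wrapping torus box -/

section TorusPoincare

variable {lo hi : Fin P.d → ℤ}

/-- ★ **THE TORUS (1.8)** (vector form).  On a NON-WRAPPING box `[lo, hi]` of `T^{(j)}` with sides `hi_κ + 1 − lo_κ ≤ 100M`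
(`1 ≤ M`), a bond field `W : VecField P j (Fin D → ℝ)` in the AXIAL COMB GAUGE (`W = 0` on `combBonds lo hi`) satisfies
`Σ_{b ∈ S_b} |W(b)|² ≤ d(100M)^{d+1} Σ_{p ∈ S_p} |(∂W)(p)|²` — `∂ = LatticeFieldCalculus.curl 1`, `|·|² = Σ_a (·)_a²` — for ANY
finset `S_b` of box bonds (`↑S_b ⊆ boxBonds lo hi`) and ANY finset `S_p ⊇ boxPlaqs lo hi` of torus plaquettes: print's *«Using
the fact that Λ is a rectangular parallelepiped contained in a cube of the size 100M, and that G₀ determines the axial gauge in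
Λ, we obtain the inequality Σ_{b∈Λ}|B′(b)|² ≦ d(100M)^{d+1} Σ_{p∈Λ}|(∂B′)(p)|²»* on the torus carrier of `Setup` — the
Literature's PROVED `ℤ^d` theorem `B16Eq18Proof.ineq18_box_vec` transported along §1–§2. [cite: Balaban1989LargeFieldII, (1.8) p.358] [folklore] -/
theorem ineq18_torusBox_of_combGauge (hN : ∀ κ, hi κ - lo κ < P.sitesPerDir j) (M : ℕ) (hM : 1 ≤ M)
    (hsides : ∀ κ, hi κ + 1 - lo κ ≤ 100 * M) {D : ℕ} (W : VecField P j (Fin D → ℝ))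
    (hW : ∀ b ∈ (combBonds lo hi : Finset (PBond P j)), W b = 0)
    (Sb : Finset (PBond P j)) (hSb : ∀ b ∈ Sb, b ∈ (boxBonds lo hi : Set (PBond P j)))
    (Sp : Finset (Plaq P j)) (hSp : (boxPlaqs lo hi : Set (Plaq P j)) ⊆ ↑Sp) :
    Ineq18 (∑ b ∈ Sb, ∑ a, (W b a) ^ 2) (∑ p ∈ Sp, ∑ a, (curl 1 W p a) ^ 2) P.d M := by
  have h18 := ineq18_box_vec (d := P.d) M hM (sides_le_of_le hsides) lo
    (fun bd : (Fin P.d → ℤ) × Fin P.d => W ⟨castSite bd.1, bd.2⟩) (comp_castBond_eq_zero_of_combGauge W hW)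
  unfold Ineq18 at h18 ⊢
  have hM0 : (0 : ℝ) ≤ (P.d : ℝ) * (100 * (M : ℝ)) ^ (P.d + 1) := by positivity
  calc ∑ b ∈ Sb, ∑ a, (W b a) ^ 2
      ≤ ∑ bd ∈ innerBonds (fun κ => (hi κ + 1 - lo κ).toNat) lo, ∑ a, (W ⟨castSite bd.1, bd.2⟩ a) ^ 2 :=
        sum_boxBonds_le_sum_innerBonds hN (fun b => ∑ a, (W b a) ^ 2) (fun b => Finset.sum_nonneg fun a _ => sq_nonneg _)
          Sb hSb
    _ ≤ (P.d : ℝ) * (100 * (M : ℝ)) ^ (P.d + 1) *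
          ∑ q ∈ innerPlaq (fun κ => (hi κ + 1 - lo κ).toNat) lo, ∑ a,
            B6TreeGaugePoincare.curl (fun bd : (Fin P.d → ℤ) × Fin P.d => W ⟨castSite bd.1, bd.2⟩ a) q.1 q.2.1 q.2.2 ^ 2 :=
        h18
    _ ≤ (P.d : ℝ) * (100 * (M : ℝ)) ^ (P.d + 1) * ∑ p ∈ Sp, ∑ a, (curl 1 W p a) ^ 2 := by
        refine mul_le_mul_of_nonneg_left ?_ hM0
        refine sum_innerPlaq_le_sum_boxPlaqs hN (fun p => ∑ a, (curl 1 W p a) ^ 2)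
          (fun p => Finset.sum_nonneg fun a _ => sq_nonneg _) _ (fun q _ h => ?_) Sp hSp
        exact Finset.sum_congr rfl fun a _ => by rw [curl_one_castSite_apply]

/-- ★ **THE TORUS (1.8)**, real-valued form (`W : VecField P j ℝ`; the abelian ∕ one-component reading):
`Σ_{b ∈ S_b} W(b)² ≤ d(100M)^{d+1} Σ_{p ∈ S_p} (∂W)(p)²` under the same letters. [cite: Balaban1989LargeFieldII, (1.8) p.358] [folklore] -/
theorem ineq18_torusBox_of_combGauge_real (hN : ∀ κ, hi κ - lo κ < P.sitesPerDir j) (M : ℕ) (hM : 1 ≤ M)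
    (hsides : ∀ κ, hi κ + 1 - lo κ ≤ 100 * M) (W : VecField P j ℝ)
    (hW : ∀ b ∈ (combBonds lo hi : Finset (PBond P j)), W b = 0)
    (Sb : Finset (PBond P j)) (hSb : ∀ b ∈ Sb, b ∈ (boxBonds lo hi : Set (PBond P j)))
    (Sp : Finset (Plaq P j)) (hSp : (boxPlaqs lo hi : Set (Plaq P j)) ⊆ ↑Sp) :
    Ineq18 (∑ b ∈ Sb, (W b) ^ 2) (∑ p ∈ Sp, (curl 1 W p) ^ 2) P.d M := by
  have h18 := ineq18_box_real (d := P.d) M hM (sides_le_of_le hsides) lo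
    (fun bd : (Fin P.d → ℤ) × Fin P.d => W ⟨castSite bd.1, bd.2⟩) (comp_castBond_eq_zero_of_combGauge W hW)
  unfold Ineq18
  have hM0 : (0 : ℝ) ≤ (P.d : ℝ) * (100 * (M : ℝ)) ^ (P.d + 1) := by positivity
  calc ∑ b ∈ Sb, (W b) ^ 2
      ≤ ∑ bd ∈ innerBonds (fun κ => (hi κ + 1 - lo κ).toNat) lo, (W ⟨castSite bd.1, bd.2⟩) ^ 2 :=
        sum_boxBonds_le_sum_innerBonds hN (fun b => (W b) ^ 2) (fun b => sq_nonneg _) Sb hSb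
    _ ≤ (P.d : ℝ) * (100 * (M : ℝ)) ^ (P.d + 1) *
          ∑ q ∈ innerPlaq (fun κ => (hi κ + 1 - lo κ).toNat) lo,
            B6TreeGaugePoincare.curl (fun bd : (Fin P.d → ℤ) × Fin P.d => W ⟨castSite bd.1, bd.2⟩) q.1 q.2.1 q.2.2 ^ 2 :=
        h18
    _ ≤ (P.d : ℝ) * (100 * (M : ℝ)) ^ (P.d + 1) * ∑ p ∈ Sp, (curl 1 W p) ^ 2 := by
        refine mul_le_mul_of_nonneg_left ?_ hM0
        refine sum_innerPlaq_le_sum_boxPlaqs hN (fun p => (curl 1 W p) ^ 2) (fun p => sq_nonneg _) _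
          (fun q _ h => ?_) Sp hSp
        have := curl_one_castSite_apply (fun b (_ : Fin 1) => W b) 0 q.1 h
        rw [show curl 1 (fun b (_ : Fin 1) => W b) ⟨castSite q.1, q.2.1, q.2.2, h⟩ 0 =
            curl 1 W ⟨castSite q.1, q.2.1, q.2.2, h⟩ by simp only [curl, one_smul, Pi.add_apply, Pi.sub_apply]] at this
        rw [this]

end TorusPoincare

/-! ## §4  ★★ The (1.9) binder on `BlockChartSU N b`, for EVERY block `b` of box bonds off the comb, from the (1.7) row in
TORUS letters -/

section BlockChart

variable {N : ℕ} {lo hi : Fin P.d → ℤ}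

/-- ★★ **(1.9) ON `BlockChartSU N b` FROM (1.7) + THE TORUS (1.8), FOR EVERY BLOCK `b` OF BOX BONDS OFF THE COMB** (junction №5's
letters `hbox`, `hcomb`; non-wrapping box, sides `≤ 100M`, `1 ≤ M`).  Extend a chart vector `v` by ZERO to a bond field `v̄` on ALL
torus bonds (`v̄ ⟨bd⟩ = v bd` on `b`, `0` off `b` — in the comb gauge since `b` misses the comb).  If the quadratic member obeys
print's (1.7) row against the TORUS curl energy `Σ_{p ∈ S_p} Σ_a |(curl 1 v̄)(p)_a|²` over any finset `S_p ⊇ boxPlaqs lo hi` and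
`Σ_{b′} ‖v b′‖²`, for every `v`, and `1 ≤ d`, `0 ≤ γ₀`, the smallness line hold, then `∀ v, Ineq19 (Qf v) (Σ ‖v b′‖²) γ₀ d M` —
the ENDs' `h19` with NO `ℤ^d` object displayed (`ineq19_of_17_18` + §3 ★). [cite: Balaban1989LargeFieldII, (1.7)–(1.9) p.358] [folklore] -/
theorem ineq19_blockChartSU_of_ineq17_torus (hN : ∀ κ, hi κ - lo κ < P.sitesPerDir j) (M : ℕ) (hd : 1 ≤ P.d)
    (hsides : ∀ κ, hi κ + 1 - lo κ ≤ 100 * M) (hM : 1 ≤ M) (b : Finset (PBond P j))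
    (hbox : ∀ i ∈ b, i ∈ (boxBonds lo hi : Set (PBond P j)))
    (hcomb : ∀ i ∈ b, i ∉ (combBonds lo hi : Finset (PBond P j)))
    (Qf : BlockChartSU N b → ℝ) {γ₀ C Rk εk : ℝ} (hγ : 0 ≤ γ₀)
    (Sp : Finset (Plaq P j)) (hSp : (boxPlaqs lo hi : Set (Plaq P j)) ⊆ ↑Sp)
    (h17 : ∀ v : BlockChartSU N b, Ineq17 (Qf v)
      (∑ p ∈ Sp, ∑ a : Fin (dimSU N),
        curl 1 (fun (bd : PBond P j) (a' : Fin (dimSU N)) => if h : bd ∈ b then v ⟨bd, h⟩ a' else (0 : ℝ)) p a ^ 2)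
      (∑ i, ‖v i‖ ^ 2) γ₀ C M Rk εk)
    (hsmall : C * ((M : ℝ) ^ 6 * Rk * εk + Real.exp (-Rk)) ≤ γ₀ / (2 * P.d * (100 * (M : ℝ)) ^ (P.d + 1))) :
    ∀ v : BlockChartSU N b, Ineq19 (Qf v) (∑ i, ‖v i‖ ^ 2) γ₀ P.d M := by
  intro v
  have hM' : (0 : ℝ) < (M : ℝ) := by exact_mod_cast hM
  have hnB : (0 : ℝ) ≤ ∑ i, ‖v i‖ ^ 2 := Finset.sum_nonneg fun i _ => sq_nonneg _
  -- the zero-extension is in the comb gauge: `b` misses the comb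
  have hW : ∀ bd ∈ (combBonds lo hi : Finset (PBond P j)),
      (fun (bd : PBond P j) (a' : Fin (dimSU N)) => if h : bd ∈ b then v ⟨bd, h⟩ a' else (0 : ℝ)) bd = 0 := by
    intro bd hbd
    funext a'
    simp only [dif_neg (fun h => hcomb bd h hbd), Pi.zero_apply]
  -- THE TORUS (1.8) on the block `b` itself (`hbox`) against `S_p`
  have h18 := ineq18_torusBox_of_combGauge hN M hM hsides _ hW b hbox Sp hSp
  -- its bond side is `Σ_{b′} ‖v b′‖²`
  have hsq : ∑ bd ∈ b, ∑ a : Fin (dimSU N), (if h : bd ∈ b then v ⟨bd, h⟩ a else (0 : ℝ)) ^ 2 = ∑ i, ‖v i‖ ^ 2 := by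
    rw [← sum_sq_flatten _ v, Fintype.sum_prod_type, ← Finset.sum_coe_sort b]
    refine sum_congr rfl fun i _ => sum_congr rfl fun a _ => ?_
    simp only [dif_pos i.2]
  have h18' : Ineq18 (∑ i, ‖v i‖ ^ 2)
      (∑ p ∈ Sp, ∑ a : Fin (dimSU N),
        curl 1 (fun (bd : PBond P j) (a' : Fin (dimSU N)) => if h : bd ∈ b then v ⟨bd, h⟩ a' else (0 : ℝ)) p a ^ 2)
      P.d M := by
    rw [← hsq]
    exact h18
  exact ineq19_of_17_18 hd hM' hγ hnB (h17 v) h18' hsmall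

end BlockChart

/-! ## §5  ★★ Convexity of the (1.2)-shaped exponent on `BlockChartSU N b` from the (1.7) row in torus letters -/

section Convexity

variable {N : ℕ} {lo hi : Fin P.d → ℤ}

/-- ★★ **CONVEXITY ON `BlockChartSU N b` FROM THE (1.7) ROW IN TORUS LETTERS**, for every block `b` of box bonds off the comb =
file 5-local's ★★′-loc `convexOn_blockChartSU_expansion_of_analyticSupBound_local` with `h19` DISCHARGED by §4, the analyticity
letter and the clause `4·d·(100M)^{d+1}·S ≤ γ₀·r²` as there. [cite: Balaban1989LargeFieldII, (1.7)–(1.9) p.358] [textbook] -/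
theorem convexOn_blockChartSU_expansion_of_ineq17_torus_analyticSupBound (hN : ∀ κ, hi κ - lo κ < P.sitesPerDir j) (M : ℕ)
    (hd : 1 ≤ P.d) (hsides : ∀ κ, hi κ + 1 - lo κ ≤ 100 * M) (hM : 1 ≤ M) (b : Finset (PBond P j))
    (hbox : ∀ i ∈ b, i ∈ (boxBonds lo hi : Set (PBond P j)))
    (hcomb : ∀ i ∈ b, i ∉ (combBonds lo hi : Finset (PBond P j)))
    {K : Set (BlockChartSU N b)} (hK : Convex ℝ K) (φ Qf lin Vt : BlockChartSU N b → ℝ) (c : ℝ)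
    (hexp : ∀ v ∈ K, φ v = c + 1 / 2 * Qf v + lin v + Vt v)
    (A : Matrix (↥b × Fin (dimSU N)) (↥b × Fin (dimSU N)) ℝ)
    (hQf : ∀ v, Qf v = (fun q : ↥b × Fin (dimSU N) => v q.1 q.2) ⬝ᵥ (A *ᵥ fun q => v q.1 q.2))
    {γ₀ C Rk εk : ℝ} (hγ : 0 ≤ γ₀)
    (Sp : Finset (Plaq P j)) (hSp : (boxPlaqs lo hi : Set (Plaq P j)) ⊆ ↑Sp)
    (h17 : ∀ v : BlockChartSU N b, Ineq17 (Qf v)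
      (∑ p ∈ Sp, ∑ a : Fin (dimSU N),
        curl 1 (fun (bd : PBond P j) (a' : Fin (dimSU N)) => if h : bd ∈ b then v ⟨bd, h⟩ a' else (0 : ℝ)) p a ^ 2)
      (∑ i, ‖v i‖ ^ 2) γ₀ C M Rk εk)
    (hsmall : C * ((M : ℝ) ^ 6 * Rk * εk + Real.exp (-Rk)) ≤ γ₀ / (2 * P.d * (100 * (M : ℝ)) ^ (P.d + 1)))
    (ℓ : BlockChartSU N b →ₗ[ℝ] ℝ) (hlin : ∀ v, lin v = ℓ v)
    (Φ : (↥b × Fin (dimSU N) → ℂ) → ℂ) {r S : ℝ} (hr : 0 < r)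
    (hVt : ∀ x ∈ K, Vt x = (Φ fun q => ((x q.1 q.2 : ℝ) : ℂ)).re)
    (hΦd : ∀ x ∈ K, DifferentiableOn ℂ Φ (ball (fun q => ((x q.1 q.2 : ℝ) : ℂ)) r))
    (hΦS : ∀ x ∈ K, ∀ u ∈ ball (fun q : ↥b × Fin (dimSU N) => ((x q.1 q.2 : ℝ) : ℂ)) r, ‖Φ u‖ ≤ S)
    (hclause : 4 * P.d * (100 * (M : ℝ)) ^ (P.d + 1) * S ≤ γ₀ * r ^ 2) :
    ConvexOn ℝ K φ :=
  convexOn_blockChartSU_expansion_of_analyticSupBound_local b hK φ Qf lin Vt c hexp A hQf hd (by exact_mod_cast hM)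
    (ineq19_blockChartSU_of_ineq17_torus hN M hd hsides hM b hbox hcomb Qf hγ Sp hSp h17 hsmall) ℓ hlin Φ hr hVt hΦd
    hΦS hclause

end Convexity

/-! ## §6  A6: §4's binder list is jointly inhabited on every block off the comb — non-trivially; A2: the comb clause is
load-bearing -/

section Witness

variable {N : ℕ} {lo hi : Fin P.d → ℤ}

/-- **A6** for ★★ `ineq19_blockChartSU_of_ineq17_torus`: on every non-wrapping box and every block `b` off its comb the hypotheses
are jointly inhabited NON-TRIVIALLY — take for the quadratic member the TORUS curl energy of the zero-extended chart vector itself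
(`γ₀ = 1`, `C = 0`: the (1.7) row with equality, the smallness line `0 ≤ …`); ★★ then returns the rescaled TORUS (1.8) on the block
chart: `Σ_{b′}‖v b′‖² ∕ (2d(100M)^{d+1}) ≤ Σ_{p ∈ S_p} Σ_a |(curl 1 v̄)(p)_a|²`, for every `v`. [folklore] -/
theorem ineq17_torus_binders_inhabited (hN : ∀ κ, hi κ - lo κ < P.sitesPerDir j) (M : ℕ) (hd : 1 ≤ P.d)
    (hsides : ∀ κ, hi κ + 1 - lo κ ≤ 100 * M) (hM : 1 ≤ M) (b : Finset (PBond P j))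
    (hbox : ∀ i ∈ b, i ∈ (boxBonds lo hi : Set (PBond P j)))
    (hcomb : ∀ i ∈ b, i ∉ (combBonds lo hi : Finset (PBond P j)))
    (Sp : Finset (Plaq P j)) (hSp : (boxPlaqs lo hi : Set (Plaq P j)) ⊆ ↑Sp) (Rk εk : ℝ) :
    (∀ v : BlockChartSU N b, Ineq17
        (∑ p ∈ Sp, ∑ a : Fin (dimSU N),
          curl 1 (fun (bd : PBond P j) (a' : Fin (dimSU N)) => if h : bd ∈ b then v ⟨bd, h⟩ a' else (0 : ℝ)) p a ^ 2)
        (∑ p ∈ Sp, ∑ a : Fin (dimSU N),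
          curl 1 (fun (bd : PBond P j) (a' : Fin (dimSU N)) => if h : bd ∈ b then v ⟨bd, h⟩ a' else (0 : ℝ)) p a ^ 2)
        (∑ i, ‖v i‖ ^ 2) 1 0 M Rk εk) ∧
    (0 : ℝ) * ((M : ℝ) ^ 6 * Rk * εk + Real.exp (-Rk)) ≤ 1 / (2 * P.d * (100 * (M : ℝ)) ^ (P.d + 1)) ∧
    ∀ v : BlockChartSU N b, Ineq19
        (∑ p ∈ Sp, ∑ a : Fin (dimSU N),
          curl 1 (fun (bd : PBond P j) (a' : Fin (dimSU N)) => if h : bd ∈ b then v ⟨bd, h⟩ a' else (0 : ℝ)) p a ^ 2)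
        (∑ i, ‖v i‖ ^ 2) 1 P.d M := by
  have hsmall : (0 : ℝ) * ((M : ℝ) ^ 6 * Rk * εk + Real.exp (-Rk)) ≤ 1 / (2 * P.d * (100 * (M : ℝ)) ^ (P.d + 1)) := by
    rw [zero_mul]
    have hd0 : (0 : ℝ) < P.d := by exact_mod_cast hd
    have hM0 : (0 : ℝ) < M := by exact_mod_cast hM
    positivity
  refine ⟨fun v => ?_, hsmall, ?_⟩
  · unfold Ineq17; simp
  · exact ineq19_blockChartSU_of_ineq17_torus hN M hd hsides hM b hbox hcomb _ zero_le_one Sp hSp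
      (fun v => by unfold Ineq17; simp) hsmall

/-- **A2** (director-ym STANDING A6∕A2 RULE): THE COMB CLAUSE OF ★ `ineq18_torusBox_of_combGauge` IS LOAD-BEARING.  The CONSTANT
bond field `W ≡ 1` on all torus bonds (one component) is curl-free on EVERY torus plaquette
(`(∂W)(p) = 1 + 1 − 1 − 1 = 0`), so for it the conclusion `Ineq18 (Σ_{b ∈ S_b}|W b|²) (Σ_{p ∈ S_p}|(∂W)(p)|²) d M` FAILS on any
non-empty `S_b`, whatever `S_p`, `d`, `M` — such a `W` is of course not in the comb gauge (unless the comb misses it), which is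
exactly the clause ★ spends. [folklore] -/
theorem ineq18_torus_void_without_combGauge (Sb : Finset (PBond P j)) (hSb : Sb.Nonempty) (Sp : Finset (Plaq P j))
    (M : ℝ) :
    ¬ Ineq18 (∑ b ∈ Sb, ∑ a : Fin 1, ((fun (_ : PBond P j) (_ : Fin 1) => (1 : ℝ)) b a) ^ 2)
        (∑ p ∈ Sp, ∑ a : Fin 1, (curl 1 (fun (_ : PBond P j) (_ : Fin 1) => (1 : ℝ)) p a) ^ 2) P.d M := by
  unfold Ineq18
  have hcurl : ∀ p : Plaq P j, ∀ a : Fin 1, curl 1 (fun (_ : PBond P j) (_ : Fin 1) => (1 : ℝ)) p a = 0 := by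
    intro p a
    simp only [curl, one_smul, Pi.add_apply, Pi.sub_apply]
    ring
  have hR : ∑ p ∈ Sp, ∑ a : Fin 1, (curl 1 (fun (_ : PBond P j) (_ : Fin 1) => (1 : ℝ)) p a) ^ 2 = 0 :=
    Finset.sum_eq_zero fun p _ => Finset.sum_eq_zero fun a _ => by rw [hcurl]; ring
  have hL : ∑ b ∈ Sb, ∑ a : Fin 1, ((fun (_ : PBond P j) (_ : Fin 1) => (1 : ℝ)) b a) ^ 2 = Sb.card := by
    simp
  rw [hR, hL, mul_zero, not_le]
  exact_mod_cast hSb.card_pos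

end Witness

end Summit.QuantumFields.YangMills.Theorems.N21TorusBoxCombGaugePoincare

end
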